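import Literature.Geometry.Kaehler.AnalyticSetIsolatingPlanes
import HarnessLib

/-!
# Submanifold pieces of an analytic set carry regular points of the set

(Model space, several complex variables.) Let `A ⊆ E` be cut out by holomorphic equations near
`a ∈ A`, with "`dim_a A ≤ p`" (every regular point of `A` near `a` has codimension `≥ n - p`,
`n = dim E`), and let `N ⊆ A` be a subset which is, at `a`, a complex submanifold of dimension
`p` (a regular point of codimension `n - p` of `N`, `Literature.Geometry.Kaehler.SCV.IsRegPt`).
The main result `Literature.Geometry.Kaehler.SCV.exists_isRegPt_nhds_subset_of_subset` says:
arbitrarily close to `a` there are points `b ∈ N` which are REGULAR points of `A` of codimension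
`n - p` and near which `A` and `N` coincide (`A ∩ O ⊆ N` for an open `O ∋ b`).

This is the geometric content of [Chirka1989, §5.3 Cor. 1–2] ("`dim A ∩ A' < dim A`" for
irreducible `A ⊄ A'`) and of "`dim sng A < dim A`" [Chirka1989, §5.2 Thm. 2], isolated from the
dimension theory: in the tree it yields that two distinct irreducible analytic sets of the same
dimension `p` meet in a set without regular points of dimension `≥ p`, and that the singular
locus of an analytic set all of whose regular points have dimension `≤ p` has no regular points
of dimension `≥ p` (sibling files), the inputs for the `𝓗^{2p}`-nullity statements behind
Lelong's theorem and the additivity of the currents of holomorphic chains.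

## Proof (local analytic covers, as in [Chirka1989, §3.7, §5.1])

Take the tangent space `T = T_a N` (`dim T = p`) and an isolating plane `ι : ℂ^{n-p} → E` for `A`
at `a` transverse to `T` (`Literature.Geometry.Kaehler.SCV.exists_isolating`). In adapted
coordinates `E ≃ K × ℂ^{n-p}` (`exists_equiv_adapted`) the set `A` is, over a small polydisc, a
proper finite cover of the base ball (`exists_coverSetup`), unramified with holomorphic sheets
`σⱼ` over the dense open set `{Δ ≠ 0}` (`CoverSetup.exists_cover_structure`); by transversality
`N` is near `a` the graph of a holomorphic section `s` of the base projection (implicit function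
theorem, `isGraphPointOver_of_isCompl_ker`). Over a base point `z₀` close to `a₁` with
`Δ z₀ ≠ 0`, `s z₀` lies on one sheet `σ_{j₀}`, and by continuity `s = σ_{j₀}` nearby (the other
sheets are excluded on an open set); the sheet point `b = s z₀ ∈ N` is a regular point of `A`
(`isRegPt_of_sheets`), and on the open set where the other sheets are excluded `A` is the graph of
`σ_{j₀} = s`, i.e. contained in `N`.

No named facts, no definitions.

## References

* E. M. Chirka, *Complex Analytic Sets*, Kluwer (1989), Ch. 1 §2.3, §3.5 Prop. 1, §3.7 Thm.,
  §5.2 Thm. 2, §5.3 Cor. 1–2 (pp. 53–55) [Chirka1989].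
-/

open Complex Metric Set Filter Function
open scoped Topology Manifold

namespace Literature.Geometry.Kaehler

variable {E : Type*} [NormedAddCommGroup E] [NormedSpace ℂ E]

namespace SCV

section Core

variable [FiniteDimensional ℂ E]

/-- **Submanifold pieces carry regular points — core form** (`dim E = p + (m + 1)`): see the
module docstring. Given `W ∈ 𝓝 a`, there is `b ∈ N ∩ W` which is a regular point of `A` of
codimension `m + 1` and an open `O ∋ b` with `A ∩ O ⊆ N`.
[Chirka, *Complex Analytic Sets*, §3.7 Thm., §5.2 Thm. 2, §5.3 Cor. 1] [folklore] -/
theorem exists_isRegPt_nhds_subset_of_subset_core {A N : Set E} {a : E} {p m : ℕ}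
    (hn : Module.finrank ℂ E = p + (m + 1))
    (hA : Literature.Analysis.Complex.SCV.IsZeroSetAt A a) (haA : a ∈ A)
    (hdim : ∀ᶠ x in 𝓝 a, x ∈ A → ∀ q, IsRegPt A q x → Module.finrank ℂ E ≤ q + p)
    (hNA : N ⊆ A) (haN : a ∈ N) (hN : IsRegPt N (m + 1) a) {W : Set E} (hW : W ∈ 𝓝 a) :
    ∃ b ∈ N, b ∈ W ∧ IsRegPt A (m + 1) b ∧ ∃ O : Set E, IsOpen O ∧ b ∈ O ∧ A ∩ O ⊆ N := by
  classical
  -- Step 1: the tangent space `T` of `N` at `a`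
  obtain ⟨UN, hUNo, haUN, gN, hgN, hNU, hsurjN⟩ := hN
  set T : Submodule ℂ E :=
    LinearMap.ker ((fderiv ℂ gN a : E →L[ℂ] (Fin (m + 1) → ℂ)) : E →ₗ[ℂ] (Fin (m + 1) → ℂ))
    with hT
  have hTdim : Module.finrank ℂ T = p := by
    have h1 := LinearMap.finrank_range_add_finrank_ker
      ((fderiv ℂ gN a : E →L[ℂ] (Fin (m + 1) → ℂ)) : E →ₗ[ℂ] (Fin (m + 1) → ℂ))
    rw [LinearMap.range_eq_top.2 hsurjN, finrank_top, Module.finrank_fin_fun, ← hT] at h1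
    omega
  -- Step 2: an isolating plane transverse to `T`
  obtain ⟨ι, hι, hιT, hiso⟩ := exists_isolating hA haA hdim T hTdim.le (m + 1) (by omega)
  -- Step 3: adapted coordinates `Θ : E ≃ K × ℂ^{m+1}` with `Θ (ι w) = (0, w)`
  obtain ⟨K, Θ, hΘι⟩ := exists_equiv_adapted ι hι
  haveI : CompleteSpace K := FiniteDimensional.complete ℂ K
  set a₁ : K := (Θ a).1 with ha₁
  set a₂ : Fin (m + 1) → ℂ := (Θ a).2 with ha₂
  have hΘa : Θ a = (a₁, a₂) := rfl
  have hdimKF : Module.finrank ℂ (K × (Fin (m + 1) → ℂ)) = Module.finrank ℂ E :=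
    Θ.toLinearEquiv.finrank_eq.symm
  -- equations of `Θ '' A` near `Θ a`
  obtain ⟨U₀, hU₀o, haU₀, N₀, f, hf, hZU₀⟩ := hA.image_equiv Θ
  -- isolation of `a₂` in the fibre of `Θ '' A` over `a₁`
  have hisoT : ∀ᶠ w in 𝓝[≠] a₂, f (a₁, w) ≠ 0 := by
    have hpt : ∀ w, ((a₁, w) : K × (Fin (m + 1) → ℂ)) = Θ (a + ι (w - a₂)) := by
      intro w
      rw [map_add, hΘι, hΘa, Prod.mk_add_mk, add_zero, add_sub_cancel]
    have ht : Tendsto (fun w : Fin (m + 1) → ℂ => w - a₂) (𝓝[≠] a₂) (𝓝[≠] 0) := by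
      refine tendsto_nhdsWithin_of_tendsto_nhds_of_eventually_within _ ?_ ?_
      · have : Tendsto (fun w : Fin (m + 1) → ℂ => w - a₂) (𝓝 a₂) (𝓝 (a₂ - a₂)) :=
          (continuous_id.sub continuous_const).continuousAt
        rw [sub_self] at this
        exact this.mono_left nhdsWithin_le_nhds
      · exact eventually_nhdsWithin_of_forall fun w hw h0 => hw (sub_eq_zero.1 h0)
    have hmemU₀ : ∀ᶠ w in 𝓝[≠] a₂, ((a₁, w) : K × (Fin (m + 1) → ℂ)) ∈ U₀ := by
      have hc : Continuous fun w : Fin (m + 1) → ℂ => ((a₁, w) : K × (Fin (m + 1) → ℂ)) := by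
        fun_prop
      exact nhdsWithin_le_nhds (hc.continuousAt.preimage_mem_nhds (hU₀o.mem_nhds (hΘa ▸ haU₀)))
    filter_upwards [ht.eventually hiso, hmemU₀] with w hw hwU₀ hf0
    apply hw
    have hmem : ((a₁, w) : K × (Fin (m + 1) → ℂ)) ∈ (Θ '' A) ∩ U₀ := by
      rw [hZU₀]; exact ⟨hwU₀, hf0⟩
    obtain ⟨z, hzA, hz⟩ := hmem.1
    rw [hpt w] at hz
    exact Θ.injective hz ▸ hzA
  -- the local analytic cover at `Θ a`
  obtain ⟨ε, r, C, F, rr, RR, hS, hsubU₀⟩ :=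
    Literature.Analysis.Complex.SCV.exists_coverSetup hU₀o hf haU₀ hisoT
  set P : Set (K × (Fin (m + 1) → ℂ)) := ball a₁ ε ×ˢ ball a₂ r with hP
  have hPo : IsOpen P := isOpen_ball.prod isOpen_ball
  have haP : Θ a ∈ P := ⟨mem_ball_self hS.ε_pos, mem_ball_self hS.r_pos⟩
  have hPU₀ : P ⊆ U₀ := fun x hx => hsubU₀ ⟨hx.1, ball_subset_closedBall hx.2⟩
  have hmemA : ∀ x ∈ P, x ∈ Θ '' A ↔ f x = 0 := fun x hx =>
    ⟨fun h => (hZU₀.subset ⟨h, hPU₀ hx⟩).2, fun h => (hZU₀.symm.subset ⟨hPU₀ hx, h⟩).1⟩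
  obtain ⟨Δ, -, hΔne, hcov⟩ := hS.exists_cover_structure
  -- Step 4: `Θ '' N` is the graph of a holomorphic section `s` of the base projection near `Θ a`
  set ℓ : (K × (Fin (m + 1) → ℂ)) →L[ℂ] K := ContinuousLinearMap.fst ℂ K (Fin (m + 1) → ℂ)
    with hℓ
  set gN' : (K × (Fin (m + 1) → ℂ)) → (Fin (m + 1) → ℂ) := gN ∘ Θ.symm with hgN'
  have hUN'o : IsOpen (Θ '' UN) := Θ.toHomeomorph.isOpenMap UN hUNo
  have haUN' : Θ a ∈ Θ '' UN := mem_image_of_mem Θ haUN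
  have hgN'd : DifferentiableOn ℂ gN' (Θ '' UN) := by
    refine hgN.comp Θ.symm.differentiableOn fun y hy => ?_
    obtain ⟨x, hx, rfl⟩ := hy
    simpa using hx
  have hN'U : Θ '' N ∩ Θ '' UN = Θ '' UN ∩ gN' ⁻¹' {0} := by
    ext y
    constructor
    · rintro ⟨⟨x, hxN, rfl⟩, hyU⟩
      refine ⟨hyU, ?_⟩
      obtain ⟨x', hx'U, hx'⟩ := hyU
      obtain rfl : x' = x := Θ.injective hx'
      have hx0 : x' ∈ gN ⁻¹' {0} := (hNU.subset ⟨hxN, hx'U⟩).2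
      simpa [hgN'] using hx0
    · rintro ⟨⟨x, hxU, rfl⟩, hy0⟩
      have hx0 : gN x = 0 := by simpa [hgN'] using hy0
      exact ⟨⟨x, (hNU.symm.subset ⟨hxU, hx0⟩).1, rfl⟩, ⟨x, hxU, rfl⟩⟩
  have hfd' : fderiv ℂ gN' (Θ a) =
      (fderiv ℂ gN a).comp (Θ.symm : (K × (Fin (m + 1) → ℂ)) →L[ℂ] E) := by
    rw [hgN', ContinuousLinearEquiv.comp_right_fderiv, ContinuousLinearEquiv.symm_apply_apply]
  have hsurj' : Function.Surjective (fderiv ℂ gN' (Θ a)) := by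
    rw [hfd']
    exact hsurjN.comp Θ.symm.surjective
  -- transversality: `ker d(gN')(Θ a) ⊕ ker ℓ = K × ℂ^{m+1}`
  have hinf : LinearMap.ker ((fderiv ℂ gN' (Θ a) : (K × (Fin (m + 1) → ℂ)) →L[ℂ]
      (Fin (m + 1) → ℂ)) : (K × (Fin (m + 1) → ℂ)) →ₗ[ℂ] (Fin (m + 1) → ℂ)) ⊓
        LinearMap.ker (ℓ : (K × (Fin (m + 1) → ℂ)) →ₗ[ℂ] K) = ⊥ := by
    rw [Submodule.eq_bot_iff]
    rintro ⟨k, w⟩ hkw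
    obtain ⟨hk1, hk2⟩ := Submodule.mem_inf.1 hkw
    have hk0 : k = 0 := LinearMap.mem_ker.1 hk2
    subst hk0
    have h0w : ((0 : K), w) = Θ (ι w) := (hΘι w).symm
    rw [LinearMap.mem_ker, ContinuousLinearMap.coe_coe, hfd', h0w] at hk1
    have hk1' : fderiv ℂ gN a (ι w) = 0 := by
      simpa using hk1
    have hmem : ι w ∈ LinearMap.range (ι : (Fin (m + 1) → ℂ) →ₗ[ℂ] E) ⊓ T :=
      Submodule.mem_inf.2 ⟨⟨w, rfl⟩, by rw [hT, LinearMap.mem_ker]; exact hk1'⟩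
    rw [hιT, Submodule.mem_bot] at hmem
    have hw : w = 0 := hι (by rw [hmem, map_zero])
    simp [hw]
  have hcompl : IsCompl (LinearMap.ker ((fderiv ℂ gN' (Θ a) : (K × (Fin (m + 1) → ℂ)) →L[ℂ]
      (Fin (m + 1) → ℂ)) : (K × (Fin (m + 1) → ℂ)) →ₗ[ℂ] (Fin (m + 1) → ℂ)))
        (LinearMap.ker (ℓ : (K × (Fin (m + 1) → ℂ)) →ₗ[ℂ] K)) := by
    refine IsCompl.of_eq hinf (Submodule.eq_top_of_disjoint _ _ ?_ (disjoint_iff.2 hinf))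
    have hker1 : Module.finrank ℂ (LinearMap.ker ((fderiv ℂ gN' (Θ a) :
        (K × (Fin (m + 1) → ℂ)) →L[ℂ] (Fin (m + 1) → ℂ)) :
          (K × (Fin (m + 1) → ℂ)) →ₗ[ℂ] (Fin (m + 1) → ℂ))) = p := by
      have h1 := LinearMap.finrank_range_add_finrank_ker ((fderiv ℂ gN' (Θ a) :
        (K × (Fin (m + 1) → ℂ)) →L[ℂ] (Fin (m + 1) → ℂ)) :
          (K × (Fin (m + 1) → ℂ)) →ₗ[ℂ] (Fin (m + 1) → ℂ))
      rw [LinearMap.range_eq_top.2 hsurj', finrank_top, Module.finrank_fin_fun, hdimKF] at h1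
      omega
    have hker2 : Module.finrank ℂ (LinearMap.ker (ℓ : (K × (Fin (m + 1) → ℂ)) →ₗ[ℂ] K)) =
        m + 1 := by
      rw [hℓ, ContinuousLinearMap.coe_fst, LinearMap.ker_fst,
        LinearMap.finrank_range_of_inj LinearMap.inr_injective, Module.finrank_fin_fun]
    rw [hker1, hker2, hdimKF, hn]
  obtain ⟨V, hVo, haV, V', hV'o, hVV', s, hsd, hℓs, hNV⟩ :=
    isGraphPointOver_of_isCompl_ker (ℓ := ℓ) (A := Θ '' N) hUN'o haUN' hgN'd hN'U
      (mem_image_of_mem Θ haN) hsurj' (fun z => ⟨(z, 0), rfl⟩) hcompl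
  -- the section `s` near `a₁`: `s a₁ = Θ a`
  have ha₁V' : a₁ ∈ V' := hVV' haV
  have hsa : s a₁ = Θ a := by
    have : Θ a ∈ Θ '' N ∩ V := ⟨mem_image_of_mem Θ haN, haV⟩
    rw [hNV] at this
    exact this.2
  have hsc : ContinuousAt s a₁ := (hsd.differentiableAt (hV'o.mem_nhds ha₁V')).continuousAt
  have hΘW : Θ '' W ∈ 𝓝 (Θ a) := Θ.toHomeomorph.isOpenMap.image_mem_nhds hW
  have hsev : ∀ᶠ z' in 𝓝 a₁, z' ∈ V' ∧ z' ∈ ball a₁ ε ∧ s z' ∈ V ∧ s z' ∈ P ∧ s z' ∈ Θ '' W := by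
    have h3 : ∀ᶠ z' in 𝓝 a₁, s z' ∈ V ∩ P ∩ Θ '' W := by
      apply hsc.preimage_mem_nhds
      rw [hsa]
      exact inter_mem (inter_mem (hVo.mem_nhds haV) (hPo.mem_nhds haP)) hΘW
    filter_upwards [hV'o.mem_nhds ha₁V', ball_mem_nhds a₁ hS.ε_pos, h3] with z' h1 h2 h4
    exact ⟨h1, h2, h4.1.1, h4.1.2, h4.2⟩
  obtain ⟨η, hη, hηball⟩ := Metric.eventually_nhds_iff_ball.1 hsev
  -- points of the graph of `s` over `ball a₁ η` are points of `Θ '' N`, of `P`, zeros of `f`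
  have hs1 : ∀ z' ∈ ball a₁ η, (s z').1 = z' := fun z' hz' => hℓs z' (hηball z' hz').1
  have hsN : ∀ z' ∈ ball a₁ η, s z' ∈ Θ '' N := by
    intro z' hz'
    have : s z' ∈ {z ∈ V | s (ℓ z) = z} :=
      ⟨(hηball z' hz').2.2.1, by show s (s z').1 = s z'; rw [hs1 z' hz']⟩
    rw [← hNV] at this
    exact this.1
  have hf0 : ∀ z' ∈ ball a₁ η, f (z', (s z').2) = 0 := by
    intro z' hz'
    have h := (hmemA _ (hηball z' hz').2.2.2.1).1 (image_mono hNA (hsN z' hz'))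
    have heq : ((z', (s z').2) : K × (Fin (m + 1) → ℂ)) = s z' := Prod.ext (hs1 z' hz').symm rfl
    rwa [heq]
  -- Step 5: a base point `z₀` near `a₁` over which the cover is unramified
  have hfreq : ∃ᶠ z in 𝓝 a₁, Δ z ≠ 0 := by
    have := hΔne a₁ (mem_ball_self hS.ε_pos)
    simpa [Filter.EventuallyEq, Filter.not_eventually] using this
  obtain ⟨z₀, hΔz₀, hz₀η⟩ := (hfreq.and_eventually (ball_mem_nhds a₁ hη)).exists
  obtain ⟨hz₀V', hz₀ε, -, hsz₀P, hsz₀W⟩ := hηball z₀ hz₀η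
  obtain ⟨δ, hδ, hδsub, nn, σ, hσd, hσinj, -, hσiff⟩ := hcov z₀ hz₀ε hΔz₀
  -- over `ball z₀ δ ∩ ball a₁ η` the section lies on some sheet
  have hsheet : ∀ z' ∈ ball z₀ δ ∩ ball a₁ η, ∃ j, (s z').2 = σ j z' := fun z' hz' =>
    (hσiff z' hz'.1 (s z').2 (ball_subset_closedBall (hηball z' hz'.2).2.2.2.1.2)).1
      (hf0 z' hz'.2)
  obtain ⟨j₀, hj₀⟩ := hsheet z₀ ⟨mem_ball_self hδ, hz₀η⟩
  -- Step 6: on an open set `G ∋ z₀` the section follows the sheet `σ j₀`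
  set D : Set K := ball z₀ δ ∩ ball a₁ η with hD
  have hDo : IsOpen D := isOpen_ball.inter isOpen_ball
  have hDV' : D ⊆ V' := fun z' hz' => (hηball z' hz'.2).1
  have hsD : ContinuousOn s D := hsd.continuousOn.mono hDV'
  have hz₀D : z₀ ∈ D := ⟨mem_ball_self hδ, hz₀η⟩
  set X : Fin nn → Set K := fun j => {z' | z' ∈ D ∧ (s z').2 - σ j z' ≠ 0} with hX
  have hXo : ∀ j, IsOpen (X j) := fun j => by
    have hc : ContinuousOn (fun z' => (s z').2 - σ j z') D :=
      (continuous_snd.comp_continuousOn hsD).sub ((hσd j).continuousOn.mono inter_subset_left)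
    exact hc.isOpen_inter_preimage hDo isOpen_compl_singleton
  set G : Set K := D ∩ ⋂ j ∈ Finset.univ.filter (· ≠ j₀), X j with hG
  have hGo : IsOpen G := hDo.inter (isOpen_biInter_finset fun j _ => hXo j)
  have hz₀G : z₀ ∈ G := by
    refine ⟨hz₀D, mem_iInter₂.2 fun j hj => ⟨hz₀D, ?_⟩⟩
    have hne : j ≠ j₀ := (Finset.mem_filter.1 hj).2
    rw [hj₀]
    exact sub_ne_zero.2 (hσinj z₀ (mem_ball_self hδ) j₀ j hne.symm)
  have hGsheet : ∀ z' ∈ G, (s z').2 = σ j₀ z' := by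
    intro z' hz'
    obtain ⟨j, hj⟩ := hsheet z' hz'.1
    by_cases hjj : j = j₀
    · rw [← hjj]; exact hj
    · exfalso
      have hzX : z' ∈ X j :=
        mem_iInter₂.1 hz'.2 j (Finset.mem_filter.2 ⟨Finset.mem_univ _, hjj⟩)
      exact hzX.2 (by rw [hj, sub_self])
  -- Step 7: the sheet point `b' = s z₀ = (z₀, σ j₀ z₀)` is a regular point of `Θ '' A`
  have hw₀ : σ j₀ z₀ ∈ ball a₂ r := by rw [← hj₀]; exact hsz₀P.2
  have hZ' : ∀ z' ∈ ball z₀ δ, ∀ w ∈ ball a₂ r,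
      ((z', w) : K × (Fin (m + 1) → ℂ)) ∈ Θ '' A ↔ ∃ j, w = σ j z' := by
    intro z' hz' w hw
    have hmemP : ((z', w) : K × (Fin (m + 1) → ℂ)) ∈ P := ⟨hδsub hz', hw⟩
    rw [hmemA _ hmemP]
    exact hσiff z' hz' w (ball_subset_closedBall hw)
  have hreg' : IsRegPt (Θ '' A) (m + 1) (z₀, σ j₀ z₀) := isRegPt_of_sheets hδ hσd hσinj hZ' j₀ hw₀
  have hb'eq : s z₀ = (z₀, σ j₀ z₀) := Prod.ext (hs1 z₀ hz₀η) hj₀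
  -- Step 8: the open set `O'` around `b'` on which the other sheets are excluded
  set B : Set (K × (Fin (m + 1) → ℂ)) := ball z₀ δ ×ˢ ball a₂ r with hB
  have hBo : IsOpen B := isOpen_ball.prod isOpen_ball
  set Y : Fin nn → Set (K × (Fin (m + 1) → ℂ)) := fun j => {x | x ∈ B ∧ x.2 - σ j x.1 ≠ 0}
    with hY
  have hYo : ∀ j, IsOpen (Y j) := by
    intro j
    have hc : ContinuousOn (fun x : K × (Fin (m + 1) → ℂ) => x.2 - σ j x.1) B :=
      continuousOn_snd.sub ((hσd j).continuousOn.comp continuousOn_fst fun x hx => hx.1)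
    exact hc.isOpen_inter_preimage hBo isOpen_compl_singleton
  set O' : Set (K × (Fin (m + 1) → ℂ)) := (G ×ˢ ball a₂ r) ∩ ⋂ j ∈ Finset.univ.filter (· ≠ j₀), Y j
    with hO'
  have hO'o : IsOpen O' := (hGo.prod isOpen_ball).inter (isOpen_biInter_finset fun j _ => hYo j)
  have hb'O' : ((z₀, σ j₀ z₀) : K × (Fin (m + 1) → ℂ)) ∈ O' := by
    refine ⟨⟨hz₀G, hw₀⟩, mem_iInter₂.2 fun j hj => ⟨⟨mem_ball_self hδ, hw₀⟩, ?_⟩⟩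
    have hne : j ≠ j₀ := (Finset.mem_filter.1 hj).2
    exact sub_ne_zero.2 (hσinj z₀ (mem_ball_self hδ) j₀ j hne.symm)
  have hO'N : Θ '' A ∩ O' ⊆ Θ '' N := by
    rintro ⟨z', w⟩ ⟨hxA, ⟨hz'G, hw⟩, hxY⟩
    have hz'δ : z' ∈ ball z₀ δ := hz'G.1.1
    obtain ⟨j, hj⟩ := (hZ' z' hz'δ w hw).1 hxA
    have hjj : j = j₀ := by
      by_contra hjj
      have hxYj : ((z', w) : K × (Fin (m + 1) → ℂ)) ∈ Y j :=
        mem_iInter₂.1 hxY j (Finset.mem_filter.2 ⟨Finset.mem_univ _, hjj⟩)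
      exact hxYj.2 (by show w - σ j z' = 0; rw [hj, sub_self])
    subst hjj
    have hsx : s z' = (z', w) := Prod.ext (hs1 z' hz'G.1.2) (by rw [hj]; exact hGsheet z' hz'G)
    rw [← hsx]
    exact hsN z' hz'G.1.2
  -- Step 9: back to `E`
  refine ⟨Θ.symm (z₀, σ j₀ z₀), ?_, ?_, ?_, Θ.symm '' O', Θ.symm.toHomeomorph.isOpenMap O' hO'o,
    ⟨(z₀, σ j₀ z₀), hb'O', rfl⟩, ?_⟩
  · obtain ⟨x, hxN, hx⟩ := hsN z₀ hz₀η
    rw [← hb'eq, ← hx, ContinuousLinearEquiv.symm_apply_apply]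
    exact hxN
  · obtain ⟨x, hxW, hx⟩ := hsz₀W
    rw [← hb'eq, ← hx, ContinuousLinearEquiv.symm_apply_apply]
    exact hxW
  · have := hreg'.image_equiv Θ.symm
    simpa [Set.image_image] using this
  · rintro x ⟨hxA, y, hyO', rfl⟩
    have hyA : y ∈ Θ '' A := ⟨Θ.symm y, hxA, Θ.apply_symm_apply y⟩
    obtain ⟨x', hx'N, hx'⟩ := hO'N ⟨hyA, hyO'⟩
    rw [← hx', ContinuousLinearEquiv.symm_apply_apply]
    exact hx'N

/-- **A `p`-dimensional submanifold piece of an analytic set of dimension `≤ p` carries regular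
points of the set, near which the two agree.** Let `A ⊆ E` be cut out by holomorphic equations
near `a ∈ A`, suppose every regular point of `A` near `a` has codimension `≥ n - p`
(`n = dim E`, "`dim_a A ≤ p`"), and let `N ⊆ A` contain `a` as a regular point of codimension
`n - p`. Then in every neighbourhood `W` of `a` there is `b ∈ N` which is a regular point of `A` of
codimension `n - p`, together with an open `O ∋ b` such that `A ∩ O ⊆ N`. (This is how
[Chirka1989] derives "`dim sng A < dim A`" and "`dim A ∩ A' < dim A`" from the local
parametrisation theorem.) [Chirka, *Complex Analytic Sets*, §3.7 Thm., §5.2 Thm. 2, §5.3 Cor. 1]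
[folklore] -/
theorem exists_isRegPt_nhds_subset_of_subset {A N : Set E} {a : E} {p : ℕ}
    (hA : Literature.Analysis.Complex.SCV.IsZeroSetAt A a) (haA : a ∈ A)
    (hdim : ∀ᶠ x in 𝓝 a, x ∈ A → ∀ q, IsRegPt A q x → Module.finrank ℂ E ≤ q + p)
    (hNA : N ⊆ A) (haN : a ∈ N) (hN : IsRegPt N (Module.finrank ℂ E - p) a)
    {W : Set E} (hW : W ∈ 𝓝 a) :
    ∃ b ∈ N, b ∈ W ∧ IsRegPt A (Module.finrank ℂ E - p) b ∧
      ∃ O : Set E, IsOpen O ∧ b ∈ O ∧ A ∩ O ⊆ N := by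
  by_cases hp : p < Module.finrank ℂ E
  · obtain ⟨m, hm⟩ : ∃ m, Module.finrank ℂ E - p = m + 1 := ⟨Module.finrank ℂ E - p - 1, by omega⟩
    rw [hm] at hN ⊢
    exact exists_isRegPt_nhds_subset_of_subset_core (by omega) hA haA hdim hNA haN hN hW
  · -- `p ≥ n`: `N` is a neighbourhood of `a`, and so is `A`
    have h0 : Module.finrank ℂ E - p = 0 := by omega
    rw [h0] at hN ⊢
    obtain ⟨U, hUo, haU, g, -, hNU, -⟩ := hN
    have hUN : U ⊆ N := fun x hx => by
      have : x ∈ U ∩ g ⁻¹' {0} := ⟨hx, Subsingleton.elim _ _⟩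
      exact (hNU.symm.subset this).1
    obtain ⟨ρ, hρ, hball⟩ := Metric.isOpen_iff.1 hUo a haU
    exact ⟨a, haN, mem_of_mem_nhds hW,
      isRegPt_zero_of_ball_subset (hball.trans (hUN.trans hNA)) (mem_ball_self hρ),
      U, hUo, haU, fun x hx => hUN hx.2⟩

end Core

end SCV

end Literature.Geometry.Kaehler
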